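import Mathlib
import HarnessLib
import Summits.ResolutionOfSingularities.ResolutionOfSingularities.Theorems.HomologicalConductorPersistenceLossArBridge
import Summits.ResolutionOfSingularities.ResolutionOfSingularities.Theorems.HomologicalConductorPersistenceKnorrerTransfer

/-!
# Crux `Persistence` (stmt-ResolutionOfSingularities-16484), chain W4.4b — (ζ) part 3:
# R4-LOST-ALL-`r`: `z^a t^{c₀} ∉ caᵐ(K[x,y,z,t] ⧸ (xy − z^{r+1}))` whenever `a + c₀ < r`

Route `ResolutionOfSingularities/HomologicalConductor`.  OURS (cell res-hironaka, crux chain W4.4b,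
planner res-L1-w44b-plan-1 CUTS 2026-08-27 «(ζ)(iii)», seat res-D-pv-026); nothing here is a
statement of the manuscript under review (Hironaka 2017); AI-written, weaker than expert review.

ASSEMBLY of four kernel pieces: res-type-010's KNÖRRER CERTIFICATE TRANSFER
`KnorrerTransfer.not_mem_cohomologyAnnihilatorOfDegree_knorrer` (U13 — itself through the LOST criterion
U10b `LostAssembly`/`LostCertificate` and res-D-pv-058's U7c), applied along
`ι = iotaHom : K[t][z] → K[x,y,z,t]` (`z ↦ X 2`, `t ↦ X 3`) with the retraction `π = piHom` killing
`x = X 0`, `y = X 1`; the matrix factorisation `(φ_N, ψ_N)` of `z^{r+1}` over `K[t][z]` with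
`N = t·J_{r+1}` (`…LossAr` §0); and «no certificate for `z^a t^{c₀}`» (`…LossArBridge` §4, i.e. U14
through the bridge).  Headline: `pow_z_mul_pow_t_not_mem_cohomologyAnnihilatorOfDegree`
(`a + c₀ < r`), `pow_z_not_mem_cohomologyAnnihilatorOfDegree` (`a < r`; `r = 3, a = 2` is U12
`LossSpecimenA3`), `z_not_mem_cohomologyAnnihilatorOfDegree` (`r ≥ 2`: the product rule for the
cohomology annihilator fails for EVERY `A_r × line`, `r ≥ 2`, in every characteristic).  [OURS]
-/

noncomputable section

-- single-problem summit: the doubled namespace component `ResolutionOfSingularities` is forced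
set_option linter.dupNamespace false

open Matrix Polynomial
open Literature.RingTheory.CohomologyAnnihilator
open Summit.ResolutionOfSingularities.ResolutionOfSingularities.Theorems.HomologicalConductor.KnorrerTransfer

universe u

namespace Summit.ResolutionOfSingularities.ResolutionOfSingularities.Theorems.HomologicalConductor.LossAr

/-! ## §5 R4-LOST-ALL-`r`: `z^a t^{c₀} ∉ caᵐ(K[x,y,z,t] ⧸ (xy − z^{r+1}))` for `a + c₀ < r` (U13 assembly) -/

section Assembly

variable (K : Type u) [Field K]

/-- `ι : K[t][z] → K[x,y,z,t]`, `z ↦ X 2`, `t ↦ X 3` (`x = X 0`, `y = X 1`). [OURS · L1 w44b] -/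
def iotaHom : Polynomial (Polynomial K) →+* MvPolynomial (Fin 4) K :=
  Polynomial.eval₂RingHom (Polynomial.eval₂RingHom MvPolynomial.C (MvPolynomial.X 3)) (MvPolynomial.X 2)

/-- The retraction `π : K[x,y,z,t] → K[t][z]` killing `x, y`. [OURS · L1 w44b] -/
def piHom : MvPolynomial (Fin 4) K →+* Polynomial (Polynomial K) :=
  MvPolynomial.eval₂Hom (Polynomial.C.comp Polynomial.C)
    ![0, 0, Polynomial.X, Polynomial.C Polynomial.X]

/-- `ι` on scalars. [folklore] -/
theorem iotaHom_C_C (c : K) : iotaHom K (Polynomial.C (Polynomial.C c)) = MvPolynomial.C c := by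
  simp [iotaHom]

/-- `ι t = X 3`. [folklore] -/
theorem iotaHom_C_X : iotaHom K (Polynomial.C Polynomial.X) = MvPolynomial.X 3 := by
  simp [iotaHom]

/-- `ι z = X 2`. [folklore] -/
theorem iotaHom_X : iotaHom K Polynomial.X = MvPolynomial.X 2 := by
  simp [iotaHom]

/-- `π` on the variables: `x, y ↦ 0`, `X 2 ↦ z`, `X 3 ↦ t`. [folklore] -/
theorem piHom_X (i : Fin 4) :
    piHom K (MvPolynomial.X i) = ![0, 0, Polynomial.X, Polynomial.C Polynomial.X] i := by
  simp [piHom]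

/-- `π` on scalars. [folklore] -/
theorem piHom_C (c : K) : piHom K (MvPolynomial.C c) = Polynomial.C (Polynomial.C c) := by
  simp [piHom]

/-- `π ∘ ι = id`. [OURS · L1 w44b] -/
theorem piHom_comp_iotaHom : (piHom K).comp (iotaHom K) = RingHom.id _ := by
  refine Polynomial.ringHom_ext' (Polynomial.ringHom_ext' ?_ ?_) ?_
  · ext c
    simp [iotaHom_C_C, piHom_C]
  · simp [iotaHom_C_X, piHom_X]
  · simp [iotaHom_X, piHom_X]

/-- `π (ι s) = s` (U13's retraction hypothesis `hπ`). [OURS · L1 w44b] -/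
theorem piHom_iotaHom (s : Polynomial (Polynomial K)) : piHom K (iotaHom K s) = s :=
  RingHom.congr_fun (piHom_comp_iotaHom K) s

/-- `xy − z^{r+1} ≠ 0` in `K[x,y,z,t]` (evaluate at `(0,0,1,0)`), hence a non-zero-divisor. [folklore] -/
theorem X_mul_X_sub_X_pow_mem_nonZeroDivisors (r : ℕ) :
    (MvPolynomial.X 0 * MvPolynomial.X 1 - MvPolynomial.X 2 ^ (r + 1) : MvPolynomial (Fin 4) K) ∈
      nonZeroDivisors (MvPolynomial (Fin 4) K) := by
  refine mem_nonZeroDivisors_of_ne_zero fun h => ?_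
  have h1 := congrArg (MvPolynomial.aeval ![(0 : K), 0, 1, 0]) h
  simp at h1

/-- **R4-LOST-ALL-`r` (OURS · w44b (ζ)(iii)).**  For every field `K`, every `r`, and all `a, c₀` with
`a + c₀ < r`: the class of `z^a t^{c₀}` does NOT lie in `caᵐ(K[x,y,z,t] ⧸ (xy − z^{r+1}))` for any `m`
(`x, y, z, t = X 0, X 1, X 2, X 3`).  Assembly: res-type-010's KNÖRRER TRANSFER
`KnorrerTransfer.not_mem_cohomologyAnnihilatorOfDegree_knorrer` (U13, through the LOST criterion U10b/U7c)
along `ι : K[t][z] → K[x,y,z,t]` with retraction `π` (`x, y ↦ 0`), fed with the matrix factorisation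
`(φ_N, ψ_N)` of `z^{r+1}` over `K[t][z]`, `N = t·J_{r+1}` (§0), and `not_exists_certificate` (§4:
U14 through the bridge of §3). [OURS · L1 w44b] -/
theorem pow_z_mul_pow_t_not_mem_cohomologyAnnihilatorOfDegree (r a c₀ : ℕ) (h : a + c₀ < r) (m : ℕ) :
    Ideal.Quotient.mk (Ideal.span ({MvPolynomial.X 0 * MvPolynomial.X 1 - MvPolynomial.X 2 ^ (r + 1)} :
        Set (MvPolynomial (Fin 4) K))) (MvPolynomial.X 2 ^ a * MvPolynomial.X 3 ^ c₀) ∉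
      cohomologyAnnihilatorOfDegree (MvPolynomial (Fin 4) K ⧸ Ideal.span
        ({MvPolynomial.X 0 * MvPolynomial.X 1 - MvPolynomial.X 2 ^ (r + 1)} : Set (MvPolynomial (Fin 4) K))) m := by
  letI : Algebra (Polynomial (Polynomial K)) (MvPolynomial (Fin 4) K) := (iotaHom K).toAlgebra
  have hι : algebraMap (Polynomial (Polynomial K)) (MvPolynomial (Fin 4) K) = iotaHom K := rfl
  -- the matrix factorisation of `z^{r+1}` over `K[t][z]`
  have hN := map_C_smul_shiftMatrix_pow_eq_zero r ((Polynomial.X : Polynomial K) ^ 1) (k := r + 1) le_rfl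
  have hφψ := phiN_mul_psiN (Polynomial.X : Polynomial (Polynomial K)) r _ hN
  have hψφ := psiN_mul_phiN (Polynomial.X : Polynomial (Polynomial K)) r _ hN
  -- no small certificate (§4)
  have hno := not_exists_certificate r (A := Polynomial K) Polynomial.X Polynomial.X_ne_zero
    Polynomial.not_isUnit_X 1 (k := r + 1) le_rfl a c₀ (by omega) (by omega)
  have e1 : algebraMap (Polynomial (Polynomial K)) (MvPolynomial (Fin 4) K) (Polynomial.X ^ (r + 1)) =
      MvPolynomial.X 2 ^ (r + 1) := by
    rw [hι, map_pow, iotaHom_X]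
  have e2 : algebraMap (Polynomial (Polynomial K)) (MvPolynomial (Fin 4) K)
      (Polynomial.X ^ a * Polynomial.C (Polynomial.X ^ c₀)) = MvPolynomial.X 2 ^ a * MvPolynomial.X 3 ^ c₀ := by
    simp only [hι, map_mul, map_pow, iotaHom_X, iotaHom_C_X]
  have hf : MvPolynomial.X 0 * MvPolynomial.X 1 -
      algebraMap (Polynomial (Polynomial K)) (MvPolynomial (Fin 4) K) (Polynomial.X ^ (r + 1)) ∈
        nonZeroDivisors (MvPolynomial (Fin 4) K) := by
    rw [e1]
    exact X_mul_X_sub_X_pow_mem_nonZeroDivisors K r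
  have key := not_mem_cohomologyAnnihilatorOfDegree_knorrer (piHom K) (piHom_iotaHom K) _ _
    (Polynomial.X ^ (r + 1)) hφψ hψφ (MvPolynomial.X 0) (MvPolynomial.X 1)
    (by rw [piHom_X]; rfl) (by rw [piHom_X]; rfl) hf _ hno m
  rw [e2] at key
  rw [e1] at key
  exact key

/-- **`z^a ∉ caᵐ(K[x,y,z,t] ⧸ (xy − z^{r+1}))` for every `a < r` and every `m`** — the R4 LOST column of the
`A_r × line` table for all `r` at once (`r = 3, a = 2` is U12, `LossSpecimenA3`). [OURS · L1 w44b] -/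
theorem pow_z_not_mem_cohomologyAnnihilatorOfDegree (r a : ℕ) (ha : a < r) (m : ℕ) :
    Ideal.Quotient.mk (Ideal.span ({MvPolynomial.X 0 * MvPolynomial.X 1 - MvPolynomial.X 2 ^ (r + 1)} :
        Set (MvPolynomial (Fin 4) K))) (MvPolynomial.X 2 ^ a) ∉
      cohomologyAnnihilatorOfDegree (MvPolynomial (Fin 4) K ⧸ Ideal.span
        ({MvPolynomial.X 0 * MvPolynomial.X 1 - MvPolynomial.X 2 ^ (r + 1)} : Set (MvPolynomial (Fin 4) K))) m := by
  have h := pow_z_mul_pow_t_not_mem_cohomologyAnnihilatorOfDegree K r a 0 (by omega) m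
  rwa [pow_zero, mul_one] at h

/-- … in particular `z ∉ caᵐ(A_r × line)` for `r ≥ 2`, although `z ∈ ca(A_r)`: the product rule for the
cohomology annihilator FAILS for every `A_r`, `r ≥ 2`. [OURS · L1 w44b] -/
theorem z_not_mem_cohomologyAnnihilatorOfDegree (r : ℕ) (hr : 2 ≤ r) (m : ℕ) :
    Ideal.Quotient.mk (Ideal.span ({MvPolynomial.X 0 * MvPolynomial.X 1 - MvPolynomial.X 2 ^ (r + 1)} :
        Set (MvPolynomial (Fin 4) K))) (MvPolynomial.X 2) ∉
      cohomologyAnnihilatorOfDegree (MvPolynomial (Fin 4) K ⧸ Ideal.span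
        ({MvPolynomial.X 0 * MvPolynomial.X 1 - MvPolynomial.X 2 ^ (r + 1)} : Set (MvPolynomial (Fin 4) K))) m := by
  have h := pow_z_not_mem_cohomologyAnnihilatorOfDegree K r 1 (by omega) m
  rwa [pow_one] at h

end Assembly

end Summit.ResolutionOfSingularities.ResolutionOfSingularities.Theorems.HomologicalConductor.LossAr

end
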